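import Mathlib.Analysis.InnerProductSpace.PiL2
import Mathlib.Analysis.SpecialFunctions.Trigonometric.Basic
import Mathlib.Logic.Equiv.Fin.Rotate
import HarnessLib

/-!
# Rotation of the unit regular horizontal `n`-gon about the vertical axis

Stub N1b of line `Sketch` (skeleton v20) for crux `MoebiusLimitExists` (stmt-CriticalPhenomena-1344):
the rotation by `2π/n` about the `e₀`-axis of `ℝ³ = EuclideanSpace ℝ (Fin 3)` is a linear isometry fixing
`e₀ = EuclideanSpace.single 0 1` and permuting the vertices
`P_n i = cos(2πi/n) e₁ + sin(2πi/n) e₂` of the unit regular horizontal `n`-gon cyclically (`i ↦ finRotate n i`).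
-/

namespace Summit.CriticalPhenomena.Ising3DConformalLimit.MoebiusLimitExistsSketchV20

/-- The rotated frame `(e₀, cos θ • e₁ + sin θ • e₂, -sin θ • e₁ + cos θ • e₂)` of `ℝ³` is orthonormal
(`cos² θ + sin² θ = 1`). [folklore] -/
theorem axialRotationFrame_orthonormal (θ : ℝ) :
    Orthonormal ℝ (![EuclideanSpace.single 0 1,
        Real.cos θ • EuclideanSpace.single 1 1 + Real.sin θ • EuclideanSpace.single 2 1,
        -Real.sin θ • EuclideanSpace.single 1 1 + Real.cos θ • EuclideanSpace.single 2 1] :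
      Fin 3 → EuclideanSpace ℝ (Fin 3)) := by
  have h := Real.cos_sq_add_sin_sq θ
  rw [orthonormal_iff_ite]
  intro i j
  fin_cases i <;> fin_cases j <;>
    · simp only [Fin.zero_eta, Fin.mk_one, Fin.reduceFinMk, Fin.isValue, Matrix.cons_val_zero,
        Matrix.cons_val_one, Matrix.cons_val]
      rw [EuclideanSpace.inner_eq_star_dotProduct]
      simp [dotProduct, Fin.sum_univ_three]
      try nlinarith [h]

/-- **Axial rotations of `ℝ³`.**  For every angle `θ` there is a linear isometry `R` of
`EuclideanSpace ℝ (Fin 3)` fixing `e₀` and rotating the horizontal plane `⟨e₁, e₂⟩` by `θ`: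
`R (cos φ • e₁ + sin φ • e₂) = cos (φ + θ) • e₁ + sin (φ + θ) • e₂` (the isometry sending the standard
orthonormal basis to the rotated frame; angle-addition formulas). [folklore] -/
theorem exists_axialRotation (θ : ℝ) :
    ∃ R : EuclideanSpace ℝ (Fin 3) ≃ₗᵢ[ℝ] EuclideanSpace ℝ (Fin 3),
      R (EuclideanSpace.single 0 1) = EuclideanSpace.single 0 1 ∧
      ∀ φ : ℝ,
        R (Real.cos φ • (EuclideanSpace.single 1 1 : EuclideanSpace ℝ (Fin 3)) +
            Real.sin φ • (EuclideanSpace.single 2 1 : EuclideanSpace ℝ (Fin 3))) =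
          Real.cos (φ + θ) • (EuclideanSpace.single 1 1 : EuclideanSpace ℝ (Fin 3)) +
            Real.sin (φ + θ) • (EuclideanSpace.single 2 1 : EuclideanSpace ℝ (Fin 3)) := by
  set v : Fin 3 → EuclideanSpace ℝ (Fin 3) := ![EuclideanSpace.single 0 1,
      Real.cos θ • EuclideanSpace.single 1 1 + Real.sin θ • EuclideanSpace.single 2 1,
      -Real.sin θ • EuclideanSpace.single 1 1 + Real.cos θ • EuclideanSpace.single 2 1] with hv_def
  have hv : Orthonormal ℝ v := axialRotationFrame_orthonormal θ
  have hsp : ⊤ ≤ Submodule.span ℝ (Set.range v) :=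
    (hv.linearIndependent.span_eq_top_of_card_eq_finrank' (by simp)).ge
  have hb : ∀ k : Fin 3, (OrthonormalBasis.mk hv hsp).repr.symm (EuclideanSpace.single k 1) = v k :=
    fun k => by rw [OrthonormalBasis.repr_symm_single, OrthonormalBasis.coe_mk]
  refine ⟨(OrthonormalBasis.mk hv hsp).repr.symm, ?_, fun φ => ?_⟩
  · rw [hb]
    simp [hv_def]
  · rw [map_add, map_smul, map_smul, hb, hb, Real.cos_add, Real.sin_add]
    simp only [hv_def, Matrix.cons_val_one, Matrix.cons_val]
    ext k
    fin_cases k <;> simp <;> ring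

/-- **STUB N1b `stub_regularPolygon_rotation` (M, pure geometry).**  There is a linear isometry `R` of `ℝ³`
(the rotation by `2π/n` about the `e₀`-axis: the isometry sending the standard orthonormal basis to
`(e₀, cos(2π/n)e₁ + sin(2π/n)e₂, −sin(2π/n)e₁ + cos(2π/n)e₂)`) with `R e₀ = e₀` and
`R (P_n i) = P_n (i + 1)` for the unit regular horizontal `n`-gon `P_n i = cos(2πi/n) e₁ + sin(2πi/n) e₂`
(`finRotate n`; angle addition, and `cos`/`sin` are `2π`-periodic for the wrap-around `i = n − 1`). [folklore] -/
theorem stub_regularPolygon_rotation : ∀ n : ℕ,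
    ∃ R : EuclideanSpace ℝ (Fin 3) ≃ₗᵢ[ℝ] EuclideanSpace ℝ (Fin 3),
      R (EuclideanSpace.single 0 1) = EuclideanSpace.single 0 1 ∧
      ∀ i : Fin n,
        R (Real.cos (2 * Real.pi * ((i : ℕ) : ℝ) / (n : ℝ)) • (EuclideanSpace.single 1 1 : EuclideanSpace ℝ (Fin 3)) +
            Real.sin (2 * Real.pi * ((i : ℕ) : ℝ) / (n : ℝ)) • (EuclideanSpace.single 2 1 : EuclideanSpace ℝ (Fin 3))) =
          Real.cos (2 * Real.pi * (((finRotate n i : Fin n) : ℕ) : ℝ) / (n : ℝ)) •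
              (EuclideanSpace.single 1 1 : EuclideanSpace ℝ (Fin 3)) +
            Real.sin (2 * Real.pi * (((finRotate n i : Fin n) : ℕ) : ℝ) / (n : ℝ)) •
              (EuclideanSpace.single 2 1 : EuclideanSpace ℝ (Fin 3)) := by
  intro n
  obtain ⟨R, hR0, hR⟩ := exists_axialRotation (2 * Real.pi / (n : ℝ))
  refine ⟨R, hR0, fun i => ?_⟩
  rw [hR]
  cases n with
  | zero => exact i.elim0
  | succ m =>
    have hN : ((m + 1 : ℕ) : ℝ) ≠ 0 := by positivity
    rcases eq_or_ne i (Fin.last m) with rfl | hi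
    · -- wrap-around: the angle `2πm/(m+1) + 2π/(m+1) = 2π` versus `0`
      rw [finRotate_last]
      have h1 : 2 * Real.pi * ((Fin.last m : ℕ) : ℝ) / ((m + 1 : ℕ) : ℝ) + 2 * Real.pi / ((m + 1 : ℕ) : ℝ) =
          2 * Real.pi := by
        rw [Fin.val_last]
        field_simp
        push_cast
        ring
      rw [h1]
      simp
    · rw [coe_finRotate_of_ne_last hi]
      have h1 : 2 * Real.pi * ((i : ℕ) : ℝ) / ((m + 1 : ℕ) : ℝ) + 2 * Real.pi / ((m + 1 : ℕ) : ℝ) =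
          2 * Real.pi * (((i : ℕ) + 1 : ℕ) : ℝ) / ((m + 1 : ℕ) : ℝ) := by
        push_cast
        ring
      rw [h1]

end Summit.CriticalPhenomena.Ising3DConformalLimit.MoebiusLimitExistsSketchV20
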